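import Summits.Schanuel.Schanuel.Theorems.ZilberEacAlgebraicBranch
import Summits.Schanuel.Schanuel.Theorems.RigidCoreSchanuelOnLogFreeCoreRootGerm
import HarnessLib

/-!
# Arbitrary base branches, LXXXIX: fibre CURVES over curves defined over `ℚ̄` — the generic case
# (a simple root of an edge polynomial) via the holomorphic root germ

HONEST FRAMING.  Cell `pub-schanuel` (Zilber's Exponential-Algebraic Closedness, case ladder;
host summit Schanuel), seat 2, gen 32.  File LXXXIII is a GERM theorem: any irreducible surface
`S` of dimension `≤ 2` containing a germ `(s^{-k}, Φ(s)s^{-M}, ψ(s)s^L, e^{x₁})` over an unbounded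
place of a curve over `ℚ̄` (containing no line) is dense.  For a surface fibred in CURVES
`{x ∈ C, P(x; y₀) = 0}` the germ requires a Puiseux parametrisation of `y₀` along the place; this
file supplies it in the generic case by the holomorphic implicit function theorem
(`stub_rootGerm`, cell RigidCore, Mathlib's implicit function theorem): if after the weighted
substitution `s = σ^e`, `y₀ = σ^L y` the fibre relation becomes `Σ_{j ≤ d} Q_j(σ) y^j = 0` with `Q_j`
analytic at `0`, `Q_d(0) ≠ 0`, and the limit polynomial `Σ Q_j(0) y^j` has a SIMPLE nonzero root
`θ`, then there is an analytic root germ `y = η(σ)`, `η(0) = θ`, and `S` is dense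
(`unprojectedDense_fibreCurve_simpleRoot_algebraicCurve`).  The non-generic case (multiple edge
roots: Newton–Puiseux over analytic rows) is NOT covered.  Mantova–Masser's question (PLMS 2024
§1 p. 5) OPEN in general; EC(3,2) OPEN; NOT Schanuel's conjecture (neither used nor implied);
EAC ⇏ SC.
-/

noncomputable section

open Filter Topology Set Complex Polynomial
open Literature.NumberTheory.Transcendental Literature.ModelTheory.Zilber
open Literature.ModelTheory.ExponentialFields

set_option linter.dupNamespace false

namespace Summit.Schanuel.Schanuel.Theorems

section FibreCurveSimpleRoot

variable (F : ℂ[X][X])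

/-- `σ ↦ σ^e` (`e ≥ 1`) maps the punctured neighbourhood of `0` into itself. [folklore] -/
theorem tendsto_pow_nhdsNE_zero {e : ℕ} (he : 1 ≤ e) :
    Tendsto (fun σ : ℂ => σ ^ e) (𝓝[≠] (0 : ℂ)) (𝓝[≠] (0 : ℂ)) := by
  refine tendsto_nhdsWithin_iff.2 ⟨?_, ?_⟩
  · have h := (continuous_pow e (M := ℂ)).tendsto (0 : ℂ)
    rw [zero_pow (by omega : e ≠ 0)] at h
    exact h.mono_left nhdsWithin_le_nhds
  · exact eventually_nhdsWithin_of_forall fun σ hσ => pow_ne_zero _ hσ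

/-- **Analytic root germ through a simple root** (from `stub_rootGerm`).  `Q_j` analytic at `0`
(`j ≤ d`), `Q_d(0) ≠ 0`, `θ` a simple root of `Σ_{j ≤ d} Q_j(0) y^j`: there is `η` analytic at `0`
with `η(0) = θ` and `Σ_j Q_j(σ) η(σ)^j = 0` near `σ = 0`. [folklore] -/
theorem exists_analytic_rootGerm (d : ℕ) (Q : ℕ → ℂ → ℂ) (hQan : ∀ j, AnalyticAt ℂ (Q j) 0)
    (hQd : Q d 0 ≠ 0) {θ : ℂ}
    (hroot : ∑ j ∈ Finset.range (d + 1), Q j 0 * θ ^ j = 0)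
    (hsimple : ∑ j ∈ Finset.range (d + 1), (j : ℂ) * Q j 0 * θ ^ (j - 1) ≠ 0) :
    ∃ η : ℂ → ℂ, AnalyticAt ℂ η 0 ∧ η 0 = θ ∧
      ∀ᶠ σ in 𝓝 (0 : ℂ), ∑ j ∈ Finset.range (d + 1), Q j σ * η σ ^ j = 0 := by
  classical
  -- a ball on which every `Q_j` (`j ≤ d`) is differentiable and `Q_d ≠ 0`
  have hev : ∀ᶠ z in 𝓝 (0 : ℂ), (∀ j ∈ Finset.range (d + 1), DifferentiableAt ℂ (Q j) z) ∧ Q d z ≠ 0 := by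
    refine ((Finset.eventually_all (Finset.range (d + 1))).2 fun j _ => ?_).and
      ((hQan d).continuousAt.eventually_ne hQd)
    exact (hQan j).eventually_analyticAt.mono fun z hz => hz.differentiableAt
  obtain ⟨r, hr, hball⟩ := Metric.eventually_nhds_iff_ball.1 hev
  set a : Fin d → ℂ → ℂ := fun i z => Q i z / Q d z with ha
  have hadiff : ∀ i, DifferentiableOn ℂ (a i) (Metric.ball 0 r) := by
    intro i z hz
    have h := hball z hz
    exact (((h.1 i (Finset.mem_range.2 (by omega))).div (h.1 d (Finset.mem_range.2 (by omega)))
      h.2).differentiableWithinAt)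
  -- the monic normalisation
  have hsplit : ∀ (z y : ℂ), Q d z ≠ 0 →
      ∑ j ∈ Finset.range (d + 1), Q j z * y ^ j =
        Q d z * (y ^ d + ∑ i : Fin d, a i z * y ^ (i : ℕ)) := by
    intro z y hz
    rw [Finset.sum_range_succ, ← Fin.sum_univ_eq_sum_range, mul_add, Finset.mul_sum]
    have e : ∀ i : Fin d, Q d z * (a i z * y ^ (i : ℕ)) = Q (i : ℕ) z * y ^ (i : ℕ) := by
      intro i
      rw [ha]
      field_simp
    simp only [e]
    ring
  have hsplit' : ∀ (z y : ℂ), Q d z ≠ 0 →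
      ∑ j ∈ Finset.range (d + 1), (j : ℂ) * Q j z * y ^ (j - 1) =
        Q d z * ((d : ℂ) * y ^ (d - 1) + ∑ i : Fin d, ((i : ℕ) : ℂ) * a i z * y ^ ((i : ℕ) - 1)) := by
    intro z y hz
    rw [Finset.sum_range_succ, ← Fin.sum_univ_eq_sum_range, mul_add, Finset.mul_sum]
    have e : ∀ i : Fin d, Q d z * (((i : ℕ) : ℂ) * a i z * y ^ ((i : ℕ) - 1)) =
        ((i : ℕ) : ℂ) * Q (i : ℕ) z * y ^ ((i : ℕ) - 1) := by
      intro i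
      rw [ha]
      field_simp
    simp only [e]
    ring
  have hroot' : θ ^ d + ∑ i : Fin d, a i 0 * θ ^ (i : ℕ) = 0 := by
    have h := hroot
    rw [hsplit 0 θ hQd] at h
    exact (mul_eq_zero.1 h).resolve_left hQd
  have hsimple' : (d : ℂ) * θ ^ (d - 1) + ∑ i : Fin d, ((i : ℕ) : ℂ) * a i 0 * θ ^ ((i : ℕ) - 1) ≠ 0 := by
    intro h0
    apply hsimple
    rw [hsplit' 0 θ hQd, h0, mul_zero]
  obtain ⟨g, hg0, r', hr', hr'r, hgdiff, hgroot, -⟩ :=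
    RigidCore.stub_rootGerm d a 0 θ r hr hadiff hroot' hsimple'
  refine ⟨g, ?_, hg0, ?_⟩
  · exact hgdiff.analyticAt (Metric.isOpen_ball.mem_nhds (Metric.mem_ball_self hr'))
  · filter_upwards [Metric.ball_mem_nhds (0 : ℂ) hr'] with z hz
    have hzr : z ∈ Metric.ball (0 : ℂ) r := Metric.ball_subset_ball hr'r hz
    rw [hsplit z (g z) (hball z hzr).2, hgroot z hz, mul_zero]

/-- **Fibre curves over a curve over `ℚ̄`, generic case: dense.**  `F ∈ ℚ̄[x₀][x₁]` irreducible
containing no line; an unbounded place `x₀ = s^{-k}`, `x₁ = Φ(s)s^{-M}`; after `s = σ^e`,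
`y₀ = σ^L y` the fibre relation of `S` along the place reads `Σ_{j ≤ d} Q_j(σ) y^j = 0` (`Q_j`
analytic, `Q_d(0) ≠ 0`) with a SIMPLE nonzero root `θ` at `σ = 0`; `S` irreducible closed of
dimension `≤ 2` containing `(x(σ^e), yσ^L, e^{x₁})` for every root `y`.  Then `S` has Zariski-dense
exponential points. [cite: MantovaMasser2023, §1 Further remarks, p. 5 (the question, open in
general)] (new) -/
theorem unprojectedDense_fibreCurve_simpleRoot_algebraicCurve {S : Set (Fin 2 ⊕ Fin 2 → ℂ)}
    (hS : IsIrreducibleClosed ℂ S) (hdim : zariskiDim ℂ S ≤ (2 : ℕ)) (hFirr : Irreducible F)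
    (hnc : ∀ m₀ m₁ a : ℂ, m₁ ≠ 0 →
      ∃ x₀ : ℂ, (F.map (Polynomial.evalRingHom x₀)).eval ((a - m₀ * x₀) / m₁) ≠ 0)
    (halg : ∀ i j, IsAlgebraic ℚ ((F.coeff j).coeff i))
    {k M : ℕ} (hk : 1 ≤ k) (hM : 1 ≤ M) {Φ : ℂ → ℂ} (hΦ : AnalyticAt ℂ Φ 0) (hΦ0 : Φ 0 ≠ 0)
    (hplace : ∀ᶠ s in 𝓝[≠] (0 : ℂ),
      (F.map (Polynomial.evalRingHom (s ^ k)⁻¹)).eval (Φ s * (s ^ M)⁻¹) = 0)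
    {e : ℕ} (he : 1 ≤ e) (L : ℤ) (d : ℕ) (Q : ℕ → ℂ → ℂ) (hQan : ∀ j, AnalyticAt ℂ (Q j) 0)
    (hQd : Q d 0 ≠ 0) {θ : ℂ} (hθ0 : θ ≠ 0)
    (hroot : ∑ j ∈ Finset.range (d + 1), Q j 0 * θ ^ j = 0)
    (hsimple : ∑ j ∈ Finset.range (d + 1), (j : ℂ) * Q j 0 * θ ^ (j - 1) ≠ 0)
    (hsub : ∀ᶠ σ in 𝓝[≠] (0 : ℂ), ∀ y : ℂ, ∑ j ∈ Finset.range (d + 1), Q j σ * y ^ j = 0 →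
      (Sum.elim ![((σ ^ e) ^ k)⁻¹, Φ (σ ^ e) * ((σ ^ e) ^ M)⁻¹]
        ![y * σ ^ L, Complex.exp (Φ (σ ^ e) * ((σ ^ e) ^ M)⁻¹)] : Fin 2 ⊕ Fin 2 → ℂ) ∈ S) :
    UnprojectedDense S := by
  classical
  obtain ⟨η, hηan, hη0, hηroot⟩ := exists_analytic_rootGerm d Q hQan hQd hroot hsimple
  have hpow := tendsto_pow_nhdsNE_zero he
  have he0 : e ≠ 0 := by omega
  have hΦ' : AnalyticAt ℂ (fun σ : ℂ => Φ (σ ^ e)) 0 :=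
    hΦ.comp_of_eq (analyticAt_id.pow e) (by simp [zero_pow he0])
  have hΦ'0 : (fun σ : ℂ => Φ (σ ^ e)) 0 ≠ 0 := by
    show Φ (0 ^ e) ≠ 0
    rw [zero_pow he0]
    exact hΦ0
  refine unprojectedDense_branch_of_algebraicCurve F hS hdim hFirr hnc halg (k := e * k)
    (M := e * M) (Nat.mul_pos (by omega) (by omega)) (Nat.mul_pos (by omega) (by omega)) hΦ' hΦ'0
    ?_ L hηan (by rw [hη0]; exact hθ0) ?_
  · filter_upwards [hpow.eventually hplace] with σ hσ
    rw [pow_mul, pow_mul]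
    exact hσ
  · filter_upwards [hsub, hpow.eventually hplace,
      nhdsWithin_le_nhds (show {σ : ℂ | _} ∈ 𝓝 (0 : ℂ) from hηroot)] with σ hσ _ hσroot
    have h := hσ (η σ) hσroot
    rw [pow_mul, pow_mul]
    exact h

end FibreCurveSimpleRoot

end Summit.Schanuel.Schanuel.Theorems
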